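import Literature.Probability.RandomPlanarGeometry.SLEMarkovKernelBoundary
import Literature.Probability.RandomPlanarGeometry.HalfPlaneBoundaryRigidity
import HarnessLib

/-!
# The domain-Markov kernel of chordal SLE_κ: scale invariance of the image law and the
# `initial` clause

Topic `Probability/RandomPlanarGeometry`; theorems only (companion of `SLEMarkovKernel.lean`,
crux `stmt-CriticalPhenomena-0698`, stub `stub_isDomainMarkov`).

* `sleImageLaw_comp_mul` — **scale invariance of the image law**: `ψ ∘ (a • ·)` and `ψ` give
  the same law of the compactified image of the SLE_κ trace (SLE scaling
  `identDistrib_sleTrace_scale_of_hasSLETrace` + reparametrisation invariance of curve classes,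
  `IsCompactifiedImage.mk_eq_of_comp_mul`);
* `sleImageLaw_congr`, `IsSLELaw.eq_sleImageLaw` — the image law only sees `ψ` on the closed
  half-plane; an SLE law is the image law of any of its uniformizing maps;
* `sleImageLaw_eq_of_realises_carrier`, **`sleMarkovKernel_initial`** — the `initial` clause of
  `ChordalFamily.IsMarkovExtension` for the SLE kernel: a configuration realising the unexplored
  triple `(D, a, b)` parametrises `D` with boundary values `a` at `0`, `b` at `∞`, so differs
  from a chordal uniformizing map by a dilation (`ConformalEquiv.exists_eqOn_comp_mul_of_boundaryValues`,
  uniqueness of the preimage of `a` from `MarkedDomain.boundaryExtension_ofReal_ne_pt_zero`),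
  and its image law is the SLE_κ law of `D`.

References: W. Werner, *Lectures on two-dimensional critical percolation* (2007), §3.2 (2);
G. F. Lawler, *Conformally Invariant Processes in the Plane* (2005), §6.1–6.3;
S. Rohde, O. Schramm, *Basic properties of SLE*, Ann. of Math. 161 (2005), Prop. 2.1.
-/

noncomputable section

open Set Filter Topology MeasureTheory ProbabilityTheory Complex
open UpperHalfPlane (upperHalfPlaneSet isOpen_upperHalfPlaneSet)
open scoped NNReal ENNReal unitInterval

namespace Literature.Probability.RandomPlanarGeometry


/-! ### Scale invariance of the image law -/

section ImageLaw

variable {κ : ℝ≥0} {ψ : ℂ → ℂ} {b : ℂ}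

/-- The nodal curve of the compactified image IS a compactified image (definition of
`nodeValue`). [folklore] -/
theorem isCompactifiedImage_nodeValue (ψ : ℂ → ℂ) (b : ℂ) (γ : ℝ≥0 → ℂ)
    (hc : Continuous (nodeValue ψ b γ)) :
    IsCompactifiedImage ψ γ b ⟨⟨nodeValue ψ b γ, hc⟩⟩ :=
  ⟨fun _ hs ↦ nodeValue_of_lt ψ b γ hs, nodeValue_one ψ b γ⟩

/-- A dilation `w ↦ a w` (`a > 0`) composed with a function continuous on the closed half-plane
with limit `b` at infinity is again such a function. [folklore] -/
theorem continuousOn_comp_mul {a : ℝ} (ha : 0 < a) (hψc : ContinuousOn ψ {z : ℂ | 0 ≤ z.im}) :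
    ContinuousOn (fun w ↦ ψ ((a : ℂ) * w)) {z : ℂ | 0 ≤ z.im} := by
  refine hψc.comp (by fun_prop) fun w hw ↦ ?_
  simp only [mem_setOf_eq, mul_im, ofReal_re, ofReal_im, zero_mul, add_zero] at hw ⊢
  exact mul_nonneg ha.le hw

/-- Limit at infinity of the dilated function. [folklore] -/
theorem tendsto_comp_mul_cocompact {a : ℝ} (ha : 0 < a)
    (hψb : Tendsto ψ (cocompact ℂ ⊓ 𝓟 {z : ℂ | 0 ≤ z.im}) (𝓝 b)) :
    Tendsto (fun w ↦ ψ ((a : ℂ) * w)) (cocompact ℂ ⊓ 𝓟 {z : ℂ | 0 ≤ z.im}) (𝓝 b) := by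
  have hmaps : MapsTo (fun w : ℂ ↦ (a : ℂ) * w) {z : ℂ | 0 ≤ z.im} {z : ℂ | 0 ≤ z.im} := by
    intro w hw
    simp only [mem_setOf_eq, mul_im, ofReal_re, ofReal_im, zero_mul, add_zero] at hw ⊢
    exact mul_nonneg ha.le hw
  have h1 : Tendsto (fun w : ℂ ↦ (a : ℂ) * w) (cocompact ℂ) (cocompact ℂ) := by
    have := (Homeomorph.mulLeft₀ (a : ℂ) (by exact_mod_cast ha.ne') : ℂ ≃ₜ ℂ).map_cocompact
    exact this.le
  exact hψb.comp (h1.inf (tendsto_principal_principal.2 hmaps))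

/-- **Scale invariance of the image law**: replacing `ψ` by `ψ ∘ (a • ·)` (`a > 0`) does not
change the law of the compactified image of the SLE_κ trace — SLE scaling
(`identDistrib_sleTrace_scale_of_hasSLETrace`: `γ ~ a γ(·/a²)`) and invariance of curve classes
under time reparametrisation (`IsCompactifiedImage.mk_eq_of_comp_mul`). This is the source of
"chordal SLE in a domain is well defined up to a time change". [cite: Lawler2005, §6.1 and Prop. 6.5] -/
theorem sleImageLaw_comp_mul (h0 : HasSLETrace κ)
    (htr : ∀ᵐ ω ∂Process.preWienerMeasure, Tendsto (fun t ↦ ‖sleTrace κ ω t‖) atTop atTop) (hψm : Measurable ψ)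
    (hψc : ContinuousOn ψ {z : ℂ | 0 ≤ z.im})
    (hψb : Tendsto ψ (cocompact ℂ ⊓ 𝓟 {z : ℂ | 0 ≤ z.im}) (𝓝 b)) {a : ℝ} (ha : 0 < a) :
    sleImageLaw κ (fun w ↦ ψ ((a : ℂ) * w)) b = sleImageLaw κ ψ b := by
  set ψa : ℂ → ℂ := fun w ↦ ψ ((a : ℂ) * w) with hψa
  have hψam : Measurable ψa := hψm.comp (measurable_const.mul measurable_id)
  obtain ⟨an, han0, han⟩ : ∃ an : ℝ≥0, an ≠ 0 ∧ (an : ℝ) = a :=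
    ⟨a.toNNReal, (Real.toNNReal_pos.2 ha).ne', Real.coe_toNNReal a ha.le⟩
  have han2 : an ^ 2 ≠ 0 := pow_ne_zero 2 han0
  have hID := identDistrib_sleTrace_scale_of_hasSLETrace h0 han0
  have hΨ : Measurable (compactifiedClass ψ b) := measurable_compactifiedClass hψm b
  have hΨa : Measurable (compactifiedClass ψa b) := measurable_compactifiedClass hψam b
  -- a.s. identification of the two functionals
  have hae : (compactifiedClass ψ b ∘ fun ω t ↦ (an : ℂ) * sleTrace κ ω (t / an ^ 2))
      =ᵐ[Process.preWienerMeasure] (compactifiedClass ψa b ∘ fun ω ↦ sleTrace κ ω) := by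
    filter_upwards [ae_isGeneratedByCurve_sleTrace h0, htr] with ω hgen hinf
    set γ : ℝ≥0 → ℂ := sleTrace κ ω with hγ
    have hγA : ∀ t, γ t ∈ {z : ℂ | 0 ≤ z.im} := fun t ↦
      mem_closure_upperHalfPlaneSet_iff.1 (sleTrace_mem_closure κ ω t)
    have hcont : Continuous (nodeValue ψa b γ) :=
      continuous_nodeValue (continuousOn_comp_mul ha hψc) (tendsto_comp_mul_cocompact ha hψb)
        hgen.continuous hγA (tendsto_cocompact_of_tendsto_norm_atTop hinf)
    set c₁ : Curve ℂ := ⟨⟨nodeValue ψa b γ, hcont⟩⟩ with hc₁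
    have h1 : IsCompactifiedImage ψa γ b c₁ := isCompactifiedImage_nodeValue ψa b γ hcont
    -- the same curve is the compactified `ψ`-image of `t ↦ a γ t = G (an² t)`
    set G : ℝ≥0 → ℂ := fun t ↦ (an : ℂ) * γ (t / an ^ 2) with hG
    have h2 : IsCompactifiedImage ψ (fun t ↦ G (an ^ 2 * t)) b c₁ := by
      refine ⟨fun s hs ↦ ?_, h1.2⟩
      rw [h1.1 s hs, hψa, hG]
      simp only
      rw [mul_div_cancel_left₀ _ han2, han]
    have h3 := IsCompactifiedImage.of_comp_mul han2 h2
    simp only [Function.comp_apply]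
    rw [h3.compactifiedClass_eq, CurveClass.mk_reparam, h1.compactifiedClass_eq]
  unfold sleImageLaw
  calc Process.preWienerMeasure.map (fun ω ↦ compactifiedClass ψa b (sleTrace κ ω))
      = Process.preWienerMeasure.map (compactifiedClass ψa b ∘ fun ω ↦ sleTrace κ ω) := rfl
    _ = Process.preWienerMeasure.map
          (compactifiedClass ψ b ∘ fun ω t ↦ (an : ℂ) * sleTrace κ ω (t / an ^ 2)) :=
        (Measure.map_congr hae).symm
    _ = (Process.preWienerMeasure.map fun ω t ↦ (an : ℂ) * sleTrace κ ω (t / an ^ 2)).map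
          (compactifiedClass ψ b) :=
        (AEMeasurable.map_map_of_aemeasurable hΨ.aemeasurable hID.aemeasurable_snd).symm
    _ = (Process.preWienerMeasure.map fun ω ↦ sleTrace κ ω).map (compactifiedClass ψ b) := by
        rw [hID.map_eq]
    _ = Process.preWienerMeasure.map (compactifiedClass ψ b ∘ fun ω ↦ sleTrace κ ω) :=
        AEMeasurable.map_map_of_aemeasurable hΨ.aemeasurable hID.aemeasurable_fst
    _ = Process.preWienerMeasure.map (fun ω ↦ compactifiedClass ψ b (sleTrace κ ω)) := rfl

end ImageLaw



/-! ### Transport of a conformal equivalence along an equality of targets -/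

/-- Casting a conformal equivalence along an equality of targets does not change the map. [folklore] -/
theorem ConformalEquiv.cast_apply {U V V' : Set ℂ} (h : V = V') (e : ConformalEquiv U V) (w : ℂ) :
    (h ▸ e) w = e w := by
  subst h
  rfl

/-- Casting along an equality of targets does not change boundary values. [folklore] -/
theorem ConformalEquiv.hasBoundaryValue_cast_iff {U V V' : Set ℂ} (h : V = V') (e : ConformalEquiv U V)
    {x p : ℂ} : (h ▸ e).HasBoundaryValue x p ↔ e.HasBoundaryValue x p := by
  subst h
  rfl

/-- Casting along an equality of targets does not change the boundary value at infinity. [folklore] -/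
theorem ConformalEquiv.hasBoundaryValueAtInfty_cast_iff {U V V' : Set ℂ} (h : V = V')
    (e : ConformalEquiv U V) {p : ℂ} : (h ▸ e).HasBoundaryValueAtInfty p ↔ e.HasBoundaryValueAtInfty p := by
  subst h
  rfl

/-! ### The image law only sees `ψ` on the closed half-plane -/

section Congr

variable {κ : ℝ≥0}

/-- `compactifiedClass` depends on `Φ` only through its values on the range of the path. [folklore] -/
theorem compactifiedClass_congr {Φ Φ' : ℂ → ℂ} {b : ℂ} {w : ℝ≥0 → ℂ}
    (h : ∀ t, Φ (w t) = Φ' (w t)) : compactifiedClass Φ b w = compactifiedClass Φ' b w := by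
  have hnode : nodeValue Φ b w = nodeValue Φ' b w := by
    funext s
    unfold nodeValue
    split_ifs
    · exact h _
    · rfl
  unfold compactifiedClass compactifiedLimit
  have happ : compactifiedApprox Φ b w = compactifiedApprox Φ' b w := by
    funext n
    unfold compactifiedApprox
    rw [hnode]
  rw [happ]

/-- **Image laws of maps that agree on the closed half-plane coincide.** [folklore] -/
theorem sleImageLaw_congr {ψ ψ' : ℂ → ℂ} {b : ℂ} (h : ∀ z : ℂ, 0 ≤ z.im → ψ z = ψ' z) :
    sleImageLaw κ ψ b = sleImageLaw κ ψ' b := by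
  unfold sleImageLaw
  congr 1
  funext ω
  exact compactifiedClass_congr fun t ↦
    h _ (mem_closure_upperHalfPlaneSet_iff.1 (sleTrace_mem_closure κ ω t))

/-- **An SLE law is the image law of (the boundary extension of) any of its uniformizing
maps**, extended to `ℂ` by the vertical projection. [cite: Lawler2005, §6.3] -/
theorem IsSLELaw.eq_sleImageLaw {D : DobrushinDomain} {μ : Measure (CurveClass ℂ)}
    {Γ : (ℝ≥0 → ℝ) → CurveClass ℂ} {φ : ConformalEquiv upperHalfPlaneSet D.carrier}
    (hμ : μ = Process.preWienerMeasure.map Γ)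
    (hae : ∀ᵐ ω ∂Process.preWienerMeasure, ∃ c : Curve ℂ, Γ ω = CurveClass.mk c ∧
      IsCompactifiedImage φ.boundaryExtension (sleTrace κ ω) (D.pt 1) c) :
    μ = sleImageLaw κ (fun w ↦ φ.boundaryExtension (projH w)) (D.pt 1) := by
  rw [hμ, sleImageLaw]
  refine Measure.map_congr ?_
  filter_upwards [hae] with ω ⟨c, hΓ, hc⟩
  rw [hΓ]
  have hc' : IsCompactifiedImage (fun w ↦ φ.boundaryExtension (projH w)) (sleTrace κ ω) (D.pt 1) c :=
    hc.congr_left fun t ↦ by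
      rw [projH_of_im_nonneg (mem_closure_upperHalfPlaneSet_iff.1 (sleTrace_mem_closure κ ω t))]
  exact hc'.compactifiedClass_eq.symm

end Congr

/-! ### The `initial` clause -/

section Initial

variable {κ : ℝ≥0}

/-- A configuration realising the unexplored triple `(D, a, b)`: any driving function generated
by a curve, at time `0` (the hull is empty, the tip is `Φ 0 = a`). [folklore] -/
theorem exists_realises_carrier (h0 : HasSLETrace κ) (D : DobrushinDomain) :
    ∃ c : SLEConfig, c.Realises D.carrier (D.pt 0) (D.pt 1) := by
  haveI := isProbabilityMeasure_preWienerMeasure'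
  -- a sample path whose chain is generated by a curve
  haveI : (ae Process.preWienerMeasure).NeBot := ae_neBot.2 (IsProbabilityMeasure.ne_zero _)
  obtain ⟨ω₀, hω₀⟩ : ∃ ω₀ : ℝ≥0 → ℝ, ∃ γ, Loewner.IsGeneratedByCurve (sleDriving κ ω₀) γ :=
    Filter.Eventually.exists h0
  obtain ⟨φ, hφ⟩ := MarkedDomain.exists_isChordalUniformizing_holds D
  refine ⟨⟨D, φ, hφ, sleDriving κ ω₀, continuous_sleDriving κ ω₀, hω₀, 0⟩, ?_, ?_, rfl⟩
  · -- remaining domain: the hull at time `0` is empty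
    change φ.boundaryExtension '' (upperHalfPlaneSet \ Loewner.hull (sleDriving κ ω₀) 0) = D.carrier
    rw [Loewner.hull_zero_holds (continuous_sleDriving κ ω₀), Set.sdiff_empty]
    rw [image_congr fun z hz ↦ φ.boundaryExtension_eq hz]
    exact φ.bijOn.image_eq
  · -- tip: `Φ (γ 0) = Φ (W 0) = Φ 0 = a`
    change φ.boundaryExtension (Loewner.trace (sleDriving κ ω₀) 0) = D.pt 0
    rw [Loewner.trace_zero, sleDriving_zero, ofReal_zero]
    exact hφ.boundaryExtension_zero

/-- **The image law of a configuration realising `(D, a, b)` is the SLE law of `D`.** The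
configuration's parametrisation and any chordal uniformizing map of `D` differ by a dilation
(rigidity, with uniqueness of the preimage of `a` from the boundary correspondence), and the
image law is dilation invariant. [cite: Lawler2005, §6.1 and §6.3] -/
theorem sleImageLaw_eq_of_realises_carrier (h0 : HasSLETrace κ)
    (htr : ∀ᵐ ω ∂Process.preWienerMeasure, Tendsto (fun t ↦ ‖sleTrace κ ω t‖) atTop atTop) {D : DobrushinDomain} {μ : Measure (CurveClass ℂ)}
    (hμ : IsSLELaw κ D μ) {c : SLEConfig} (hc : c.Realises D.carrier (D.pt 0) (D.pt 1)) :
    sleImageLaw κ c.ψ (D.pt 1) = μ := by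
  obtain ⟨Γ, ⟨hΓm, φ, hφ, hae⟩, rfl⟩ := hμ
  obtain ⟨hdom, htip, htgt⟩ := hc
  have hC := JordanDomain.exists_continuousOn_extension_holds
  -- rigidity: `c.ψ = Φ ∘ (cst • ·)` on `ℍₒ`
  set ψ₂ : ConformalEquiv upperHalfPlaneSet D.carrier := hdom ▸ c.conf with hψ₂
  have hbv : ∀ x : ℝ, ∃ p, φ.HasBoundaryValue x p := fun x ↦
    let ⟨p, _, hp⟩ := JordanDomain.exists_hasBoundaryValue_holds D.toJordanDomain φ x
    ⟨p, hp⟩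
  have huniq : ∀ x : ℝ, φ.HasBoundaryValue x (D.pt 0) → x = 0 := by
    intro x hx
    by_contra hx0
    have heq : φ.boundaryExtension x = D.pt 0 :=
      φ.boundaryExtension_eq_of_hasBoundaryValue (mem_closure_upperHalfPlaneSet_iff.2 (by simp)) hx
    exact MarkedDomain.boundaryExtension_ofReal_ne_pt_zero hC hφ hx0 heq
  have hb : ∀ x : ℝ, ¬ φ.HasBoundaryValue x (D.pt 1) := by
    intro x hx
    have heq : φ.boundaryExtension x = D.pt 1 :=
      φ.boundaryExtension_eq_of_hasBoundaryValue (mem_closure_upperHalfPlaneSet_iff.2 (by simp)) hx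
    exact MarkedDomain.boundaryExtension_ofReal_ne_pt_one hC hφ x heq
  have hab : D.pt 0 ≠ D.pt 1 := fun h ↦ by
    have := MarkedDomain.pt_injective D h
    exact absurd this (by decide)
  have h0₂ : ψ₂.HasBoundaryValue 0 (D.pt 0) := by
    rw [hψ₂, ConformalEquiv.hasBoundaryValue_cast_iff, ← htip]
    exact c.hasBoundaryValue_conf_zero
  have hinf₂ : ψ₂.HasBoundaryValueAtInfty (D.pt 1) := by
    rw [hψ₂, ConformalEquiv.hasBoundaryValueAtInfty_cast_iff, ← htgt]
    exact c.hasBoundaryValueAtInfty_conf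
  obtain ⟨cst, hcst, hEq⟩ := ConformalEquiv.exists_eqOn_comp_mul_of_boundaryValues φ ψ₂
    hbv hφ.1 h0₂ hφ.2 hinf₂ huniq hab hb
  -- `c.ψ = Φ ∘ (cst • ·)` on the CLOSED half-plane, by continuity
  set Φp : ℂ → ℂ := fun w ↦ φ.boundaryExtension (projH w) with hΦp
  have hΦpc : Continuous Φp := by
    have h1 := JordanDomain.continuousOn_boundaryExtension_holds D.toJordanDomain φ
    rw [ConformalEquiv.closure_upperHalfPlaneSet_eq] at h1
    exact h1.comp_continuous continuous_projH fun w ↦ projH_im_nonneg w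
  have hclosed : ∀ z : ℂ, 0 ≤ z.im → c.ψ z = Φp ((cst : ℂ) * z) := by
    have hS : EqOn c.ψ (fun z ↦ Φp ((cst : ℂ) * z)) upperHalfPlaneSet := by
      intro w hw
      have h1 : ψ₂ w = φ ((cst : ℂ) * w) := hEq hw
      rw [hψ₂, ConformalEquiv.cast_apply, c.conf_apply] at h1
      rw [h1, hΦp]
      have hw' : (cst : ℂ) * w ∈ upperHalfPlaneSet := by
        change 0 < ((cst : ℂ) * w).im
        simp only [mul_im, ofReal_re, ofReal_im, zero_mul, add_zero]
        exact mul_pos hcst hw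
      simp only
      rw [projH_of_im_nonneg hw'.le, φ.boundaryExtension_eq hw']
    have hcl : EqOn c.ψ (fun z ↦ Φp ((cst : ℂ) * z)) (closure upperHalfPlaneSet) :=
      hS.of_subset_closure c.continuous_ψ.continuousOn (hΦpc.comp (by fun_prop)).continuousOn
        subset_closure subset_rfl
    intro z hz
    exact hcl (mem_closure_upperHalfPlaneSet_iff.2 hz)
  -- conclude with scale invariance and the identification of `μ`
  have hΦpm : Measurable Φp := hΦpc.measurable
  have hΦpinf : Tendsto Φp (cocompact ℂ ⊓ 𝓟 {z : ℂ | 0 ≤ z.im}) (𝓝 (D.pt 1)) := by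
    refine (MarkedDomain.IsChordalUniformizing.tendsto_boundaryExtension_cocompact hφ).congr' ?_
    filter_upwards [mem_inf_of_right (mem_principal_self _)] with w hw
    simp only [hΦp, projH_of_im_nonneg hw]
  calc sleImageLaw κ c.ψ (D.pt 1)
      = sleImageLaw κ (fun z ↦ Φp ((cst : ℂ) * z)) (D.pt 1) := sleImageLaw_congr hclosed
    _ = sleImageLaw κ Φp (D.pt 1) :=
        sleImageLaw_comp_mul h0 htr hΦpm hΦpc.continuousOn hΦpinf hcst
    _ = Process.preWienerMeasure.map Γ :=
        (IsSLELaw.eq_sleImageLaw rfl (hae.mono fun ω h ↦ h.2)).symm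

/-- **The `initial` clause**: with nothing explored the kernel is the SLE law of `D`.
[cite: Werner2007, §3.2] -/
theorem sleMarkovKernel_initial (h0 : HasSLETrace κ)
    (htr : ∀ᵐ ω ∂Process.preWienerMeasure, Tendsto (fun t ↦ ‖sleTrace κ ω t‖) atTop atTop) {Q : ChordalFamily}
    (hQ : ∀ D : DobrushinDomain, IsSLELaw κ D (Q D)) (D : DobrushinDomain) :
    sleMarkovKernel κ D (CurveClass.mk (Curve.const (D.pt 0))) = Q D := by
  have hab : (CurveClass.mk (Curve.const (D.pt 0))).target ≠ D.pt 1 := by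
    rw [CurveClass.target_mk, Curve.target_def, Curve.const_apply]
    intro h
    exact absurd (MarkedDomain.pt_injective D h) (by decide)
  have hex : ∃ c : SLEConfig, c.Realises (remainingDomain D (CurveClass.mk (Curve.const (D.pt 0))))
      (CurveClass.mk (Curve.const (D.pt 0))).target (D.pt 1) := by
    rw [remainingDomain_mk_const, CurveClass.target_mk, Curve.target_def, Curve.const_apply]
    exact exists_realises_carrier h0 D
  rw [sleMarkovKernel_of_realises κ hab hex]
  obtain ⟨h1, h2, h3⟩ := hex.choose_spec
  have htgt : (CurveClass.mk (Curve.const (D.pt 0))).target = D.pt 0 := by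
    rw [CurveClass.target_mk, Curve.target_def, Curve.const_apply]
  exact sleImageLaw_eq_of_realises_carrier h0 htr (hQ D)
    ⟨h1.trans (remainingDomain_mk_const D), h2.trans htgt, h3⟩

end Initial

/-! ### The image law is a probability measure -/

section Probability

variable {κ : ℝ≥0}

/-- **The image law of a measurable parametrisation is a probability measure** (under
`HasSLETrace κ`, which makes the trace a.e. measurable on the canonical space). [folklore] -/
theorem isProbabilityMeasure_sleImageLaw (h0 : HasSLETrace κ) {ψ : ℂ → ℂ} (hψ : Measurable ψ)
    (b : ℂ) : IsProbabilityMeasure (sleImageLaw κ ψ b) := by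
  haveI := isProbabilityMeasure_preWienerMeasure'
  have hf : AEMeasurable (fun ω ↦ compactifiedClass ψ b (sleTrace κ ω)) Process.preWienerMeasure :=
    (measurable_compactifiedClass hψ _).comp_aemeasurable (aemeasurable_sleTrace_pi h0)
  unfold sleImageLaw
  exact Measure.isProbabilityMeasure_map hf

/-- **The SLE Markov kernel at the unexplored configuration is a probability measure.**
[folklore] -/
theorem isProbabilityMeasure_sleMarkovKernel_initial (h0 : HasSLETrace κ)
    (htr : ∀ᵐ ω ∂Process.preWienerMeasure, Tendsto (fun t ↦ ‖sleTrace κ ω t‖) atTop atTop)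
    {Q : ChordalFamily} (hQ : ∀ D : DobrushinDomain, IsSLELaw κ D (Q D)) (D : DobrushinDomain) :
    IsProbabilityMeasure (sleMarkovKernel κ D (CurveClass.mk (Curve.const (D.pt 0)))) := by
  haveI : Fact Literature.Probability.Process.isProjectiveLimit_preWienerMeasure :=
    ⟨isProjectiveLimit_preWienerMeasure_holds⟩
  rw [sleMarkovKernel_initial h0 htr hQ D]
  exact (hQ D).isProbabilityMeasure

end Probability

end Literature.Probability.RandomPlanarGeometry

end
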